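import Summits.ResolutionOfSingularities.ResolutionOfSingularities.Theorems.FrobeniusClosingSteerFreeStepSupport
import Mathlib.RingTheory.Length
import HarnessLib

/-!
# Crux `Steer` (stmt-ResolutionOfSingularities-16345), chain W4.1, hG3 WORK-DIRECT: Lemma F♭ PART 2 — the LENGTH BOUND `τ(f₀) ≥ M − 1`

OURS (campaign `res-hironaka`, rung L ★L-G4, slot W4.1; seat res-L0-w41-stub-2 g5, res-L0-w41-plan-1 RULING 136a; spec = res-L0-w41-tri-2
`gpd/audit_GPERF_DIRECT.md` §4 CLAIM F♭; replaces the role of no printed item; NOT a statement of the manuscript under review; AI-produced).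

* `G3Perf.coeff_single_zero_eq_zero_of_mem` — elements of `(X₁, X₂) + (X₀^(N+1)) ⊂ K⟦x,y,z⟧` have vanishing coefficient at `x^N`;
* `G3Perf.length_quotient_ge` — `N ≤ ℓ_R(R ⧸ ((X₁, X₂) + (X₀^N)))` for a field `K` (the chain `x^i`, one simple step at a time, via
  `Module.length_eq_add_of_exact`);
* `G3Perf.milnorLength_ge_of_free_support` — **F♭**: after `M ≥ 1` free steps of exponent `d ≥ 2` (support hypothesis of PART 1),
  `M − 1 ≤ τ(f₀) := ℓ_R(R ⧸ (∂ₓ f₀, ∂_ỹ f₀, ∂_z̃ f₀))`. With `τ(f₀) < ∞` (isolated member, PART 3) an all-free constant-order chain has at most `τ(f₀) + 1` steps.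
[folklore]
-/

noncomputable section

set_option linter.dupNamespace false

open MvPowerSeries Literature.AlgebraicGeometry.Resolution

namespace Summit.ResolutionOfSingularities.ResolutionOfSingularities.Theorems.SwitchingDichotomy.G3Perf

variable {K : Type*} [Field K]

local notation "R₃" => MvPowerSeries (Fin 3) K

/-- The ideal `(X₁, X₂) + (X₀^N)` of `K⟦x,y,z⟧`. -/
def arcIdeal (K : Type*) [Field K] (N : ℕ) : Ideal (MvPowerSeries (Fin 3) K) :=
  Ideal.span {(X 1 : MvPowerSeries (Fin 3) K), X 2} ⊔ Ideal.span {X 0 ^ N}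

/-- `arcIdeal` is antitone in `N`. -/
theorem arcIdeal_succ_le (N : ℕ) : arcIdeal K (N + 1) ≤ arcIdeal K N := by
  refine sup_le_sup_left (Ideal.span_singleton_le_span_singleton.mpr ⟨X 0, ?_⟩) _
  rw [pow_succ]

/-- Elements of `(X₁, X₂) + (X₀^(N+1))` have vanishing coefficient at the pure power `x^N`. [folklore] -/
theorem coeff_single_zero_eq_zero_of_mem {N : ℕ} {h : R₃} (hh : h ∈ arcIdeal K (N + 1)) :
    coeff (Finsupp.single 0 N) h = 0 := by
  classical
  rw [arcIdeal, Submodule.mem_sup] at hh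
  obtain ⟨u, hu, v, hv, rfl⟩ := hh
  rw [Ideal.mem_span_pair] at hu
  obtain ⟨a, b, rfl⟩ := hu
  rw [Ideal.mem_span_singleton] at hv
  have h1 : coeff (Finsupp.single (0 : Fin 3) N) (a * X 1) = 0 :=
    (X_dvd_iff.mp (Dvd.intro_left a rfl)) _ (by simp)
  have h2 : coeff (Finsupp.single (0 : Fin 3) N) (b * X 2) = 0 :=
    (X_dvd_iff.mp (Dvd.intro_left b rfl)) _ (by simp)
  have h3 : coeff (Finsupp.single (0 : Fin 3) N) v = 0 := (X_pow_dvd_iff.mp hv) _ (by simp)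
  rw [map_add, map_add, h1, h2, h3, add_zero, add_zero]

/-- `x^N ∈ (X₁, X₂) + (X₀^N)` but `x^N ∉ (X₁, X₂) + (X₀^(N+1))`. -/
theorem X_pow_mem_arcIdeal (N : ℕ) : (X 0 : R₃) ^ N ∈ arcIdeal K N :=
  Ideal.mem_sup_right (Ideal.mem_span_singleton_self _)

/-- `x^N ∉ (X₁, X₂) + (X₀^(N+1))` (its `x^N`-coefficient is `1`). -/
theorem X_pow_not_mem_arcIdeal_succ (N : ℕ) : (X 0 : R₃) ^ N ∉ arcIdeal K (N + 1) := by
  classical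
  intro h
  have := coeff_single_zero_eq_zero_of_mem h
  rw [coeff_X_pow, if_pos rfl] at this
  exact one_ne_zero this

/-- **Chain bound**: `N ≤ ℓ_R (R ⧸ ((X₁, X₂) + (X₀^N)))`, `R = K⟦x,y,z⟧`, `K` a field. [folklore] -/
theorem length_quotient_ge (N : ℕ) : (N : ℕ∞) ≤ Module.length R₃ (R₃ ⧸ arcIdeal K N) := by
  classical
  induction N with
  | zero => exact bot_le
  | succ N ih =>
    -- exact sequence 0 → ker → R/arcIdeal (N+1) → R/arcIdeal N → 0 with nontrivial kernel
    have hle : arcIdeal K (N + 1) ≤ Submodule.comap (LinearMap.id : R₃ →ₗ[R₃] R₃) (arcIdeal K N) := by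
      rw [Submodule.comap_id]; exact arcIdeal_succ_le N
    let g : (R₃ ⧸ arcIdeal K (N + 1)) →ₗ[R₃] (R₃ ⧸ arcIdeal K N) := Submodule.mapQ _ _ LinearMap.id hle
    have hg : Function.Surjective g := by
      intro q
      induction q using Submodule.Quotient.induction_on with
      | H a => exact ⟨Submodule.Quotient.mk a, rfl⟩
    have hex : Function.Exact (LinearMap.ker g).subtype g := LinearMap.exact_subtype_ker_map g
    have hlen := Module.length_eq_add_of_exact (LinearMap.ker g).subtype g (Submodule.subtype_injective _) hg hex
    have hker : Nontrivial (LinearMap.ker g) := by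
      refine ⟨⟨⟨Submodule.Quotient.mk ((X 0 : R₃) ^ N), ?_⟩, 0, ?_⟩⟩
      · rw [LinearMap.mem_ker]
        change Submodule.Quotient.mk (LinearMap.id ((X 0 : R₃) ^ N)) = (0 : R₃ ⧸ arcIdeal K N)
        rw [LinearMap.id_apply, Submodule.Quotient.mk_eq_zero]
        exact X_pow_mem_arcIdeal N
      · intro h0
        have := congrArg Subtype.val h0
        change Submodule.Quotient.mk ((X 0 : R₃) ^ N) = (0 : R₃ ⧸ arcIdeal K (N + 1)) at this
        rw [Submodule.Quotient.mk_eq_zero] at this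
        exact X_pow_not_mem_arcIdeal_succ N this
    have hpos : (1 : ℕ∞) ≤ Module.length R₃ (LinearMap.ker g) :=
      Order.one_le_iff_ne_zero.mpr (Module.length_pos_iff.mpr hker).ne'
    rw [hlen, Nat.cast_succ, add_comm]
    exact add_le_add hpos ih

variable [CharP K 2]

/-- **Lemma F♭ (length form).** In `K⟦x, ỹ, z̃⟧` (`K` a field of characteristic 2): if every odd monomial `x^a ỹ^b z̃^c` of `f₀` satisfies
`M·d ≤ a + M(b+c)` (conclusion of `free_support` after `M` free steps of exponent `d`), `2 ≤ d`, `1 ≤ M`, then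
`M − 1 ≤ τ(f₀) := ℓ (K⟦x,ỹ,z̃⟧ ⧸ (∂ₓ f₀, ∂_ỹ f₀, ∂_z̃ f₀))`. [folklore] -/
theorem milnorLength_ge_of_free_support {M d : ℕ} (hd : 2 ≤ d) (hM : 1 ≤ M) (f₀ : R₃)
    (hsupp : ∀ e : Fin 3 →₀ ℕ, (∃ i, Odd (e i)) → coeff e f₀ ≠ 0 → M * d ≤ e 0 + M * (e 1 + e 2)) :
    ((M - 1 : ℕ) : ℕ∞) ≤ Module.length R₃ (R₃ ⧸ Ideal.span (Set.range fun i : Fin 3 => MvPowerSeries.pderiv i f₀)) := by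
  have hle : Ideal.span (Set.range fun i : Fin 3 => MvPowerSeries.pderiv i f₀) ≤ arcIdeal K (M - 1) :=
    jacobian_le_of_free_support hd hM f₀ hsupp
  refine (length_quotient_ge (K := K) (M - 1)).trans ?_
  have hle' : Ideal.span (Set.range fun i : Fin 3 => MvPowerSeries.pderiv i f₀) ≤
      Submodule.comap (LinearMap.id : R₃ →ₗ[R₃] R₃) (arcIdeal K (M - 1)) := by rw [Submodule.comap_id]; exact hle
  let g : (R₃ ⧸ Ideal.span (Set.range fun i : Fin 3 => MvPowerSeries.pderiv i f₀)) →ₗ[R₃] (R₃ ⧸ arcIdeal K (M - 1)) :=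
    Submodule.mapQ _ _ LinearMap.id hle'
  have hg : Function.Surjective g := by
    intro q
    induction q using Submodule.Quotient.induction_on with
    | H a => exact ⟨Submodule.Quotient.mk a, rfl⟩
  exact Module.length_le_of_surjective g hg

end Summit.ResolutionOfSingularities.ResolutionOfSingularities.Theorems.SwitchingDichotomy.G3Perf

end
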